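import Mathlib.Analysis.CStarAlgebra.Matrix
import Mathlib.Algebra.MvPolynomial.Nilpotent
import Mathlib.RingTheory.Polynomial.UniqueFactorization
import Mathlib.LinearAlgebra.Matrix.Determinant.Basic
import Mathlib.Data.Matrix.Block
import HarnessLib

/-!
# Strictly contractive determinantal representations of strongly stable polynomials (GKVVW 2016)

Cite item `wi-21801` (route ValiantsHypothesis/ContractivityPrice). Source, read at the locator:
A. Grinshpan, D. S. Kaliuzhnyi-Verbovetskyi, V. Vinnikov, H. J. Woerdeman, *Contractive determinantal
representations of stable polynomials on a matrix polyball*, Math. Z. 283 (2016) 25–37 =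
arXiv:1503.06161 [GrinshpanEtAl2015]. Conventions (§1, p. 3): a polynomial `p ∈ ℂ[z₁, …, z_d]` is
*`𝒟`-stable* if it has no zeros in the domain `𝒟`, *strongly `𝒟`-stable* if it has no zeros in
`𝒟̄`; "`‖·‖` is the operator `(2,2)` norm"; a *strictly contractive* matrix is one with `‖K‖ < 1`.

**Theorem 3.1** (p. 8, verbatim): "Let `p` be an irreducible polynomial in the commuting
indeterminates `z^{(r)}_{ij}`, `r = 1, …, k`, `i = 1, …, ℓ_r`, `j = 1, …, m_r`, with `p(0) = 1`, which
is strongly stable with respect to the matrix polyball `𝔹^{ℓ₁×m₁} × ⋯ × 𝔹^{ℓ_k×m_k}`. Then there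
exist `n = (n₁, …, n_k) ∈ ℤ₊ᵏ` and a strict contraction `K ∈ ℂ^{Σ m_r n_r × Σ ℓ_r n_r}` so that
`p = det(I − K Z_n)`, where `Z_n = ⊕_r (Z^{(r)} ⊗ I_{n_r})`." **Corollary 3.2** (p. 9): "Every
strongly `𝔻ᵈ`-stable polynomial `p` is an eventual Agler denominator", whose proof begins "By
Theorem 3.1 applied to the polydisk case, `p` has a strictly contractive determinantal
representation (3.1)."

## What is vendored

* the named fact `gkvvw_contractive_repr` = Theorem 3.1 in the POLYDISC case `k = d`,
  `ℓ_r = m_r = 1` (so `Z_n = ⊕_j z_j I_{n_j}`), written in the Sylvester form used verbatim by route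
  ContractivityPrice: `p = det(1 + diag(X_{κ(1)}, …, X_{κ(R)}) · K)` with `κ : Fin R → σ` the
  colouring of the `R = |n|` rows by variables and `‖Matrix.toEuclideanCLM K‖ < 1` (from the printed
  `det(I − K Z_n)` by `K ↦ −K` and Sylvester's identity `det(I + AB) = det(I + BA)`; an arbitrary
  colouring `κ` is a permutation-conjugate of the block form, so this is implied by, and up to
  relabelling equivalent to, the printed conclusion);
* PROVED from it, the form the route consumes: **every** polynomial with no zero on the closed unit
  polydisc (irreducible or not, any `p(0) ≠ 0`) is `C(p(0)) · det(1 + diag(X ∘ κ) · K)` with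
  `‖K‖ < 1` (`gkvvw_contractive_repr.of_noZeroOn_closedPolydisc`) — the reduction the authors use
  in the proof of Cor. 3.2: factor into irreducibles (`ℂ[z]` is a UFD), normalise each factor by
  its value at `0`, and take the block-diagonal `K` (norm `≤ max`, determinant multiplicative:
  `exists_blockRepr`); and the weakening to `‖K‖ ≤ 1` in the exact inline shape of the route items
  (`gkvvw_contractive_repr.route`).

No bound on `R = |n|` is asserted (the paper gives none; the route's crux asks for one).

## References

* [GrinshpanEtAl2015] A. Grinshpan, D. S. Kaliuzhnyi-Verbovetskyi, V. Vinnikov, H. J. Woerdeman,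
  Contractive determinantal representations of stable polynomials on a matrix polyball, Math. Z.
  283 (2016) 25–37, arXiv:1503.06161: §1 p. 3 (stability conventions, operator norm), Thm. 3.1
  (p. 8), Cor. 3.2 and its proof (p. 9).
-/

noncomputable section

open MvPolynomial Matrix

namespace Literature.Analysis.OperatorTheory

/-- **Grinshpan–Kaliuzhnyi-Verbovetskyi–Vinnikov–Woerdeman, Theorem 3.1, polydisc case.** Let `p`
be an IRREDUCIBLE polynomial in finitely many variables `σ` over `ℂ` with `p(0) = 1` which is
strongly `𝔻^σ`-stable (no zero `z` with all `|z_j| ≤ 1`). Then there are `R ∈ ℕ` (`= |n|`), a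
STRICT contraction `K ∈ ℂ^{R×R}` for the operator `(2,2)`-norm (`‖Matrix.toEuclideanCLM K‖ < 1`) and
a colouring `κ : Fin R → σ` of the rows by variables (`Z = diag(z_{κ(i)})`, the polydisc
`Z_n = ⊕_j z_j I_{n_j}` up to relabelling) with `p = det(1 + diag(X ∘ κ) · K)` (the printed
`p = det(I − K Z_n)` after `K ↦ −K` and Sylvester's identity).
[cite: GrinshpanEtAl2015, Thm. 3.1 (p. 8), polydisc case `ℓ_r = m_r = 1`] -/
def gkvvw_contractive_repr : Prop :=
  ∀ (σ : Type) [Fintype σ] (p : MvPolynomial σ ℂ), Irreducible p → MvPolynomial.eval 0 p = 1 →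
    (∀ z : σ → ℂ, (∀ j, ‖z j‖ ≤ 1) → MvPolynomial.eval z p ≠ 0) →
      ∃ (R : ℕ) (K : Matrix (Fin R) (Fin R) ℂ) (κ : Fin R → σ),
        ‖Matrix.toEuclideanCLM (𝕜 := ℂ) K‖ < 1 ∧
          p = (1 + Matrix.diagonal (fun i => MvPolynomial.X (κ i)) *
            K.map (fun a : ℂ => (MvPolynomial.C a : MvPolynomial σ ℂ))).det

/-! ### Block-diagonal bookkeeping (the reduction to irreducible factors, proof of Cor. 3.2) -/

section Blocks

variable {σ : Type} {m n : Type} [Fintype m] [Fintype n] [DecidableEq m] [DecidableEq n]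

/-- The operator `(2,2)`-norm of a block-diagonal matrix is at most the larger block norm.
[folklore] -/
theorem norm_toEuclideanCLM_fromBlocks_le (A : Matrix m m ℂ) (D : Matrix n n ℂ) :
    ‖Matrix.toEuclideanCLM (𝕜 := ℂ) (Matrix.fromBlocks A 0 0 D)‖ ≤
      max ‖Matrix.toEuclideanCLM (𝕜 := ℂ) A‖ ‖Matrix.toEuclideanCLM (𝕜 := ℂ) D‖ := by
  set M := max ‖Matrix.toEuclideanCLM (𝕜 := ℂ) A‖ ‖Matrix.toEuclideanCLM (𝕜 := ℂ) D‖ with hM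
  have hM0 : 0 ≤ M := le_max_of_le_left (norm_nonneg _)
  refine ContinuousLinearMap.opNorm_le_bound _ hM0 fun x ↦ ?_
  let x₁ : EuclideanSpace ℂ m := WithLp.toLp 2 fun i ↦ x (Sum.inl i)
  let x₂ : EuclideanSpace ℂ n := WithLp.toLp 2 fun i ↦ x (Sum.inr i)
  have hx : ‖x‖ ^ 2 = ‖x₁‖ ^ 2 + ‖x₂‖ ^ 2 := by
    simp only [PiLp.norm_sq_eq_of_L2, x₁, x₂, Fintype.sum_sum_type]
  have h₁ : ∀ i, (Matrix.toEuclideanCLM (𝕜 := ℂ) (Matrix.fromBlocks A 0 0 D) x) (Sum.inl i) =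
      (Matrix.toEuclideanCLM (𝕜 := ℂ) A x₁) i := by
    intro i
    simp [Matrix.fromBlocks_mulVec, x₁]
    rfl
  have h₂ : ∀ i, (Matrix.toEuclideanCLM (𝕜 := ℂ) (Matrix.fromBlocks A 0 0 D) x) (Sum.inr i) =
      (Matrix.toEuclideanCLM (𝕜 := ℂ) D x₂) i := by
    intro i
    simp [Matrix.fromBlocks_mulVec, x₂]
    rfl
  have hy : ‖Matrix.toEuclideanCLM (𝕜 := ℂ) (Matrix.fromBlocks A 0 0 D) x‖ ^ 2 =
      ‖Matrix.toEuclideanCLM (𝕜 := ℂ) A x₁‖ ^ 2 + ‖Matrix.toEuclideanCLM (𝕜 := ℂ) D x₂‖ ^ 2 := by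
    simp only [PiLp.norm_sq_eq_of_L2, Fintype.sum_sum_type, h₁, h₂]
  have hb₁ : ‖Matrix.toEuclideanCLM (𝕜 := ℂ) A x₁‖ ≤ M * ‖x₁‖ :=
    (ContinuousLinearMap.le_opNorm _ _).trans
      (mul_le_mul_of_nonneg_right (le_max_left _ _) (norm_nonneg _))
  have hb₂ : ‖Matrix.toEuclideanCLM (𝕜 := ℂ) D x₂‖ ≤ M * ‖x₂‖ :=
    (ContinuousLinearMap.le_opNorm _ _).trans
      (mul_le_mul_of_nonneg_right (le_max_right _ _) (norm_nonneg _))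
  have hsq : ‖Matrix.toEuclideanCLM (𝕜 := ℂ) (Matrix.fromBlocks A 0 0 D) x‖ ^ 2 ≤ (M * ‖x‖) ^ 2 :=
    calc ‖Matrix.toEuclideanCLM (𝕜 := ℂ) (Matrix.fromBlocks A 0 0 D) x‖ ^ 2
        = ‖Matrix.toEuclideanCLM (𝕜 := ℂ) A x₁‖ ^ 2 + ‖Matrix.toEuclideanCLM (𝕜 := ℂ) D x₂‖ ^ 2 := hy
      _ ≤ (M * ‖x₁‖) ^ 2 + (M * ‖x₂‖) ^ 2 :=
        add_le_add (pow_le_pow_left₀ (norm_nonneg _) hb₁ 2) (pow_le_pow_left₀ (norm_nonneg _) hb₂ 2)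
      _ = (M * ‖x‖) ^ 2 := by rw [mul_pow, mul_pow, mul_pow, hx]; ring
  exact le_of_pow_le_pow_left₀ two_ne_zero (mul_nonneg hM0 (norm_nonneg _)) hsq

/-- Relabelling rows and columns by a bijection does not increase the operator norm. [folklore] -/
theorem norm_toEuclideanCLM_reindex_le (e : m ≃ n) (K : Matrix m m ℂ) :
    ‖Matrix.toEuclideanCLM (𝕜 := ℂ) (Matrix.reindex e e K)‖ ≤ ‖Matrix.toEuclideanCLM (𝕜 := ℂ) K‖ := by
  refine ContinuousLinearMap.opNorm_le_bound _ (norm_nonneg _) fun x ↦ ?_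
  let y : EuclideanSpace ℂ m := WithLp.toLp 2 fun j ↦ x (e j)
  have hxy : ‖y‖ = ‖x‖ := by
    have : ‖y‖ ^ 2 = ‖x‖ ^ 2 := by
      simp only [PiLp.norm_sq_eq_of_L2, y]
      exact e.sum_comp (fun j ↦ ‖x j‖ ^ 2)
    exact le_antisymm (le_of_pow_le_pow_left₀ two_ne_zero (norm_nonneg _) this.le)
      (le_of_pow_le_pow_left₀ two_ne_zero (norm_nonneg _) this.ge)
  have hentry : ∀ i, (Matrix.toEuclideanCLM (𝕜 := ℂ) (Matrix.reindex e e K) x) i =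
      (Matrix.toEuclideanCLM (𝕜 := ℂ) K y) (e.symm i) := by
    intro i
    simp [Matrix.reindex_apply, Matrix.submatrix_mulVec_equiv, y]
    rfl
  have hnorm : ‖Matrix.toEuclideanCLM (𝕜 := ℂ) (Matrix.reindex e e K) x‖ =
      ‖Matrix.toEuclideanCLM (𝕜 := ℂ) K y‖ := by
    have : ‖Matrix.toEuclideanCLM (𝕜 := ℂ) (Matrix.reindex e e K) x‖ ^ 2 =
        ‖Matrix.toEuclideanCLM (𝕜 := ℂ) K y‖ ^ 2 := by
      simp only [PiLp.norm_sq_eq_of_L2, hentry]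
      exact e.symm.sum_comp (fun j ↦ ‖(Matrix.toEuclideanCLM (𝕜 := ℂ) K y) j‖ ^ 2)
    exact le_antisymm (le_of_pow_le_pow_left₀ two_ne_zero (norm_nonneg _) this.le)
      (le_of_pow_le_pow_left₀ two_ne_zero (norm_nonneg _) this.ge)
  rw [hnorm, ← hxy]
  exact ContinuousLinearMap.le_opNorm _ _

/-- Relabelling the pencil `1 + diag(X ∘ κ) · K` does not change its determinant. [folklore] -/
theorem det_pencil_reindex (e : m ≃ n) (K : Matrix m m ℂ) (κ : m → σ) :
    (1 + Matrix.diagonal (fun i => MvPolynomial.X (κ (e.symm i))) *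
        (Matrix.reindex e e K).map (fun a : ℂ => (MvPolynomial.C a : MvPolynomial σ ℂ))).det =
      (1 + Matrix.diagonal (fun i => MvPolynomial.X (κ i)) *
        K.map (fun a : ℂ => (MvPolynomial.C a : MvPolynomial σ ℂ))).det := by
  have hmat : (1 + Matrix.diagonal (fun i => MvPolynomial.X (κ i)) *
      K.map (fun a : ℂ => (MvPolynomial.C a : MvPolynomial σ ℂ))).submatrix e.symm e.symm =
        1 + Matrix.diagonal (fun i => MvPolynomial.X (κ (e.symm i))) *
          (Matrix.reindex e e K).map (fun a : ℂ => (MvPolynomial.C a : MvPolynomial σ ℂ)) := by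
    ext i j
    simp [Matrix.diagonal_mul, Matrix.one_apply]
  rw [← hmat, Matrix.det_submatrix_equiv_self]

/-- The pencil of a block-diagonal `K` with the concatenated colouring is block-diagonal, so its
determinant is the product of the two pencil determinants. [folklore] -/
theorem det_pencil_fromBlocks (A : Matrix m m ℂ) (D : Matrix n n ℂ) (κ₁ : m → σ) (κ₂ : n → σ) :
    (1 + Matrix.diagonal (fun i => MvPolynomial.X (Sum.elim κ₁ κ₂ i)) *
        (Matrix.fromBlocks A 0 0 D).map (fun a : ℂ => (MvPolynomial.C a : MvPolynomial σ ℂ))).det =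
      (1 + Matrix.diagonal (fun i => MvPolynomial.X (κ₁ i)) *
          A.map (fun a : ℂ => (MvPolynomial.C a : MvPolynomial σ ℂ))).det *
        (1 + Matrix.diagonal (fun i => MvPolynomial.X (κ₂ i)) *
          D.map (fun a : ℂ => (MvPolynomial.C a : MvPolynomial σ ℂ))).det := by
  have hmat : 1 + Matrix.diagonal (fun i => MvPolynomial.X (Sum.elim κ₁ κ₂ i)) *
      (Matrix.fromBlocks A 0 0 D).map (fun a : ℂ => (MvPolynomial.C a : MvPolynomial σ ℂ)) =
        Matrix.fromBlocks
          (1 + Matrix.diagonal (fun i => MvPolynomial.X (κ₁ i)) *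
            A.map (fun a : ℂ => (MvPolynomial.C a : MvPolynomial σ ℂ))) 0 0
          (1 + Matrix.diagonal (fun i => MvPolynomial.X (κ₂ i)) *
            D.map (fun a : ℂ => (MvPolynomial.C a : MvPolynomial σ ℂ))) := by
    ext (i | i) (j | j) <;> simp [Matrix.diagonal_mul, Matrix.one_apply]
  rw [hmat, Matrix.det_fromBlocks_zero₂₁]

/-- **Direct sums of representations.** Two Sylvester-form representations `(K₁, κ₁)`, `(K₂, κ₂)`
combine into one of size `R₁ + R₂` with norm at most the larger of the two and determinant the
product (block-diagonal `K`, concatenated colouring). [folklore] -/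
theorem exists_blockRepr {R₁ R₂ : ℕ} (K₁ : Matrix (Fin R₁) (Fin R₁) ℂ) (κ₁ : Fin R₁ → σ)
    (K₂ : Matrix (Fin R₂) (Fin R₂) ℂ) (κ₂ : Fin R₂ → σ) :
    ∃ (K : Matrix (Fin (R₁ + R₂)) (Fin (R₁ + R₂)) ℂ) (κ : Fin (R₁ + R₂) → σ),
      ‖Matrix.toEuclideanCLM (𝕜 := ℂ) K‖ ≤
          max ‖Matrix.toEuclideanCLM (𝕜 := ℂ) K₁‖ ‖Matrix.toEuclideanCLM (𝕜 := ℂ) K₂‖ ∧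
        (1 + Matrix.diagonal (fun i => MvPolynomial.X (κ i)) *
            K.map (fun a : ℂ => (MvPolynomial.C a : MvPolynomial σ ℂ))).det =
          (1 + Matrix.diagonal (fun i => MvPolynomial.X (κ₁ i)) *
              K₁.map (fun a : ℂ => (MvPolynomial.C a : MvPolynomial σ ℂ))).det *
            (1 + Matrix.diagonal (fun i => MvPolynomial.X (κ₂ i)) *
              K₂.map (fun a : ℂ => (MvPolynomial.C a : MvPolynomial σ ℂ))).det := by
  refine ⟨Matrix.reindex finSumFinEquiv finSumFinEquiv (Matrix.fromBlocks K₁ 0 0 K₂),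
    fun i ↦ Sum.elim κ₁ κ₂ (finSumFinEquiv.symm i), ?_, ?_⟩
  · exact (norm_toEuclideanCLM_reindex_le _ _).trans (norm_toEuclideanCLM_fromBlocks_le K₁ K₂)
  · rw [det_pencil_reindex finSumFinEquiv (Matrix.fromBlocks K₁ 0 0 K₂) (Sum.elim κ₁ κ₂),
      det_pencil_fromBlocks]

end Blocks

/-! ### The form consumed by route ContractivityPrice -/

/-- **Every strongly `𝔻^σ`-stable polynomial has a strictly contractive determinantal
representation** (the use made of Thm. 3.1 in the proof of Cor. 3.2: "By Theorem 3.1 applied to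
the polydisk case, `p` has a strictly contractive determinantal representation"): if `f ∈ ℂ[σ]`,
`σ` finite, has no zero on the closed unit polydisc, then `f = C(f(0)) · det(1 + diag(X ∘ κ) · K)`
for some `R`, `K ∈ ℂ^{R×R}` with `‖K‖ < 1` and `κ : Fin R → σ`. PROVED from
`gkvvw_contractive_repr` by factoring `f` into irreducibles (`ℂ[σ]` is a UFD), normalising each
factor by its (non-zero) value at `0`, and block-diagonal assembly (`exists_blockRepr`).
[cite: GrinshpanEtAl2015, Thm. 3.1 and proof of Cor. 3.2 (p. 9)] -/
theorem gkvvw_contractive_repr.of_noZeroOn_closedPolydisc (h : gkvvw_contractive_repr) (σ : Type)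
    [Fintype σ] (f : MvPolynomial σ ℂ)
    (hf : ∀ z : σ → ℂ, (∀ j, ‖z j‖ ≤ 1) → MvPolynomial.eval z f ≠ 0) :
    ∃ (R : ℕ) (K : Matrix (Fin R) (Fin R) ℂ) (κ : Fin R → σ),
      ‖Matrix.toEuclideanCLM (𝕜 := ℂ) K‖ < 1 ∧
        f = MvPolynomial.C (MvPolynomial.eval 0 f) *
          (1 + Matrix.diagonal (fun i => MvPolynomial.X (κ i)) *
            K.map (fun a : ℂ => (MvPolynomial.C a : MvPolynomial σ ℂ))).det := by
  have h0 : ∀ j, ‖(0 : σ → ℂ) j‖ ≤ 1 := fun j ↦ by simp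
  induction f using UniqueFactorizationMonoid.induction_on_prime with
  | h₁ => exact absurd (map_zero _) (hf 0 h0)
  | h₂ u hu =>
    -- units are the non-zero constants: the empty representation
    obtain ⟨r, -, rfl⟩ := MvPolynomial.isUnit_iff_eq_C_of_isReduced.1 hu
    refine ⟨0, 0, Fin.elim0, by simp, ?_⟩
    simp
  | h₃ a q ha hq ih =>
    -- `q` prime (irreducible), `a ≠ 0`, both without zeros on the closed polydisc
    have hqz : ∀ z : σ → ℂ, (∀ j, ‖z j‖ ≤ 1) → MvPolynomial.eval z q ≠ 0 := fun z hz hz0 ↦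
      hf z hz (by rw [map_mul, hz0, zero_mul])
    have haz : ∀ z : σ → ℂ, (∀ j, ‖z j‖ ≤ 1) → MvPolynomial.eval z a ≠ 0 := fun z hz hz0 ↦
      hf z hz (by rw [map_mul, hz0, mul_zero])
    obtain ⟨R₂, K₂, κ₂, hK₂, ha_eq⟩ := ih haz
    have hc : MvPolynomial.eval 0 q ≠ 0 := hqz 0 h0
    -- normalise the irreducible factor by its value at `0` and apply Theorem 3.1
    have hunit : IsUnit (MvPolynomial.C (MvPolynomial.eval 0 q)⁻¹ : MvPolynomial σ ℂ) :=
      (Ne.isUnit (inv_ne_zero hc)).map MvPolynomial.C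
    have hirr : Irreducible (MvPolynomial.C (MvPolynomial.eval 0 q)⁻¹ * q) :=
      (irreducible_isUnit_mul hunit).2 hq.irreducible
    have hone : MvPolynomial.eval 0 (MvPolynomial.C (MvPolynomial.eval 0 q)⁻¹ * q) = 1 := by
      rw [map_mul, MvPolynomial.eval_C, inv_mul_cancel₀ hc]
    have hst : ∀ z : σ → ℂ, (∀ j, ‖z j‖ ≤ 1) →
        MvPolynomial.eval z (MvPolynomial.C (MvPolynomial.eval 0 q)⁻¹ * q) ≠ 0 := fun z hz ↦ by
      rw [map_mul, MvPolynomial.eval_C]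
      exact mul_ne_zero (inv_ne_zero hc) (hqz z hz)
    obtain ⟨R₁, K₁, κ₁, hK₁, hq_eq⟩ := h σ _ hirr hone hst
    have hq_eq' : q = MvPolynomial.C (MvPolynomial.eval 0 q) *
        (1 + Matrix.diagonal (fun i => MvPolynomial.X (κ₁ i)) *
          K₁.map (fun a : ℂ => (MvPolynomial.C a : MvPolynomial σ ℂ))).det := by
      rw [← hq_eq, ← mul_assoc, ← map_mul, mul_inv_cancel₀ hc, map_one, one_mul]
    -- block-diagonal assembly
    obtain ⟨K, κ, hK, hdet⟩ := exists_blockRepr K₁ κ₁ K₂ κ₂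
    refine ⟨R₁ + R₂, K, κ, hK.trans_lt (max_lt hK₁ hK₂), ?_⟩
    have hrhs : MvPolynomial.C (MvPolynomial.eval 0 (q * a)) *
        ((1 + Matrix.diagonal (fun i => MvPolynomial.X (κ₁ i)) *
            K₁.map (fun a : ℂ => (MvPolynomial.C a : MvPolynomial σ ℂ))).det *
          (1 + Matrix.diagonal (fun i => MvPolynomial.X (κ₂ i)) *
            K₂.map (fun a : ℂ => (MvPolynomial.C a : MvPolynomial σ ℂ))).det) =
        (MvPolynomial.C (MvPolynomial.eval 0 q) *
          (1 + Matrix.diagonal (fun i => MvPolynomial.X (κ₁ i)) *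
            K₁.map (fun a : ℂ => (MvPolynomial.C a : MvPolynomial σ ℂ))).det) *
        (MvPolynomial.C (MvPolynomial.eval 0 a) *
          (1 + Matrix.diagonal (fun i => MvPolynomial.X (κ₂ i)) *
            K₂.map (fun a : ℂ => (MvPolynomial.C a : MvPolynomial σ ℂ))).det) := by
      rw [map_mul, map_mul]; ring
    rw [hdet, hrhs, ← hq_eq', ← ha_eq]

/-- **The inline shape of route ContractivityPrice** (`‖K‖ ≤ 1`, `f = C (eval 0 f) * det(1 + diag(X ∘ κ)
* K.map C)`): every polynomial over `ℂ` in finitely many variables with no zero on the closed unit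
polydisc has a contractive determinantal representation in Sylvester form.
[cite: GrinshpanEtAl2015, Thm. 3.1 and proof of Cor. 3.2] -/
theorem gkvvw_contractive_repr.route (h : gkvvw_contractive_repr) {σ : Type} [Fintype σ]
    (f : MvPolynomial σ ℂ) (hf : ∀ z : σ → ℂ, (∀ j, ‖z j‖ ≤ 1) → MvPolynomial.eval z f ≠ 0) :
    ∃ (R : ℕ) (K : Matrix (Fin R) (Fin R) ℂ) (κ : Fin R → σ),
      ‖Matrix.toEuclideanCLM (𝕜 := ℂ) K‖ ≤ 1 ∧
        f = MvPolynomial.C (MvPolynomial.eval 0 f) *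
          (1 + Matrix.diagonal (fun i => MvPolynomial.X (κ i)) *
            K.map (fun a : ℂ => (MvPolynomial.C a : MvPolynomial σ ℂ))).det := by
  obtain ⟨R, K, κ, hK, hf⟩ := h.of_noZeroOn_closedPolydisc σ f hf
  exact ⟨R, K, κ, hK.le, hf⟩

end Literature.Analysis.OperatorTheory

end
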